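import Summits.QuantumFields.YangMills.Theorems.BalabanUVNodesPortU8ImagesKernel

/-!
# Port piece U8 — THE METHOD OF IMAGES, FILE 2b (record): THE WHOLE-TORUS WINDOW RESPONSE `windowResp F k K univ l` AND ITS FOUR TOKEN STENCILS ARE REAL PARTS OF
# PERIODISATIONS OF THE VOLUME-INDEPENDENT KERNELS `imgKer ∕ kerDiff ∕ kerLap ∕ kerCurl` (PORT-PLAN-v4 §2, record-level reading of file 2a)

Cell `ym-nodeO-ideate` ∕ `ym-balaban-port`, porter `ymgap-nodeO-port-PTB-1` (gen 5).  JOIN-side helper for **stmt-QuantumFields-27238** (K0ᴬ), `--supports … --as helper`.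
[B5] = [Balaban1984PropagatorsI], [15] = [Balaban1985Variational].

WHAT IS PROVED (kernel, sorry-free).  At the record's letters (`n = L^{k+1}`, `M = Mk (F.P K) (k+1)`, `r` any integer fine position whose class is the bond's source `EK hk x`,
label `(λ, y)`, `w = rep y`): `toT_add_unitVec_eq_EK_shift` ∕ `toT_sub_unitVec_eq_EK_unshift` (stencil points as integer steps), ★★ `windowResp_univ_eq_re_tsum` (the value:
✓`windowResp_univ_eq_re_HkOp` + file 2a's `hker_toT_eq_tsum_imgKer`), `summable_imgKer_translate_record`, and the three stencils ★★ `diffStencil_windowResp_univ_eq`,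
★★ `lapStencil_windowResp_univ_eq`, ★★ `curlStencil_windowResp_univ_eq` — the four token expressions of (‴-LocUniv) for `windowResp F k K univ` ARE `Re Σ_m 𝒦((r − n·w) + (nM)∘m)`
for `𝒦 ∈ {imgKer, kerDiff, kerLap, kerCurl}`.  All integer vectors and direction indices are typed `Fin (3 + 1)` (`(F.P K).d = 4` definitionally); the record's sites, bonds, labels
and period vectors accept them by unfolding.

HONEST FRAMING.  Bookkeeping (finite Fourier ∕ lattice arithmetic) over PROVED tree theorems; no estimate of Bałaban asserted; prepares the two-volume row (R4ᴰ)′ by images (files 3–5);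
27931 CLOSED·IMPLICATION-ONLY·IN TOTO unchanged; K0ᴬ 27238 OPEN; NODE O 0∕1; COUNT 8∕28 · K 1∕4 UNMOVED; finite `𝕋⁴_{L^K}` at fixed ε — NOT continuum ∕ OS ∕ Clay; **the Yang–Mills mass
gap (Clay) is NOT proved.**
-/

noncomputable section

open scoped BigOperators

namespace Summit.QuantumFields.YangMills.Theorems.PortU8.Images

open Literature.MathematicalPhysics.QuantumFieldTheory.Balaban1983to89
open Literature.MathematicalPhysics.QuantumFieldTheory.Balaban1983to89.T4Continuum (T4Family)
open Literature.MathematicalPhysics.QuantumFieldTheory.Balaban1983to89.B4TorusKernel.MultiPeriod (translate translate_apply)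
open Literature.MathematicalPhysics.QuantumFieldTheory.Balaban1983to89.B5Hk163Torus (hker HkOp)
open Literature.MathematicalPhysics.QuantumFieldTheory.Balaban1983to89.B5Prop11Plancherel (Tor fine)
open Literature.MathematicalPhysics.QuantumFieldTheory.Balaban1983to89.B5Eq117TorusCarriers (Mk EK)
open Literature.MathematicalPhysics.QuantumFieldTheory.Balaban1983to89.B6LowerBound2153Torus (toT rep toT_rep toT_add toT_unitVec)
open Literature.MathematicalPhysics.QuantumFieldTheory.Balaban1983to89.B6BondElimination (unitVec unitVec_apply)
open Literature.MathematicalPhysics.QuantumFieldTheory.BalabanImbrieJaffe1984to88.BIJ85Thm711TorusTransport (EK_shift)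
open Literature.MathematicalPhysics.QuantumFieldTheory.Balaban1983to89.B6HprimeOpNormV1 (EK_unshift)
open Summit.QuantumFields.YangMills.Theorems.K0RecordFormatNames

/-! ## §4  At the record's letters: the window response and its four token stencils are real parts of periodisations

All integer vectors, direction indices and the label's direction are typed `Fin (3 + 1)` (the record's dimension `(F.P K).d = 4` definitionally; the record's sites, bonds,
labels and period vectors accept them by unfolding).  The label is written `(lam, y)`. -/

section Record

variable (F : T4Family) {k : ℕ} (K : ℕ)

/-- The coarse period vector has entries `≥ 1`. [folklore] -/
theorem one_le_Mk (j : ℕ) (i : Fin (3 + 1)) : 1 ≤ Mk (F.P K) j i := Nat.one_le_iff_ne_zero.2 (NeZero.ne _)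

variable {K}

/-- `EK (x + e_ν)` is the class of `r + e_ν` when `EK x` is the class of `r`. [cite: Balaban1984PropagatorsI, (1.18) p.20] -/
theorem toT_add_unitVec_eq_EK_shift (hk : k + 1 ≤ (F.P K).m + (F.P K).K) (x : Site (F.P K) 0) (r : Fin (3 + 1) → ℤ)
    (hr : toT (d := 3 + 1) (fine (d := 3 + 1) ((F.P K).L ^ (k + 1)) (Mk (F.P K) (k + 1))) r = EK hk x) (ν : Fin (3 + 1)) :
    toT (d := 3 + 1) (fine (d := 3 + 1) ((F.P K).L ^ (k + 1)) (Mk (F.P K) (k + 1))) (r + unitVec ν) = EK hk (x.shift ν) := by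
  rw [toT_add, hr, toT_unitVec]
  exact (EK_shift hk x ν).symm

/-- `EK (x − e_ν)` is the class of `r − e_ν`. [cite: Balaban1984PropagatorsI, (1.18) p.20] -/
theorem toT_sub_unitVec_eq_EK_unshift (hk : k + 1 ≤ (F.P K).m + (F.P K).K) (x : Site (F.P K) 0) (r : Fin (3 + 1) → ℤ)
    (hr : toT (d := 3 + 1) (fine (d := 3 + 1) ((F.P K).L ^ (k + 1)) (Mk (F.P K) (k + 1))) r = EK hk x) (ν : Fin (3 + 1)) :
    toT (d := 3 + 1) (fine (d := 3 + 1) ((F.P K).L ^ (k + 1)) (Mk (F.P K) (k + 1))) (r + -unitVec ν) = EK hk (x.unshift ν) := by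
  rw [toT_add, hr, toT_neg', toT_unitVec, ← sub_eq_add_neg]
  exact (EK_unshift hk x ν).symm

/-- ★★ **THE WHOLE-TORUS WINDOW RESPONSE IS A PERIODISATION**: for any integer fine position with class `EK x′` — written `r + s` for a base `r` and a stencil step `s` —
`windowResp F k K univ (λ, y) ⟨x′, μ′⟩ = Re Σ_m imgKer n μ′ λ ((r + s − n·rep y) + (nM)∘m)`, `n = L^{k+1}`, `M = Mk (F.P K) (k+1)` (✓`windowResp_univ_eq_re_HkOp` + §3).
[cite: Balaban1984PropagatorsI, (1.63) p.28, p.36 ll.20–23; Balaban1984PropagatorsII, (2.35) p.228] -/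
theorem windowResp_univ_eq_re_tsum (hk : k + 1 ≤ (F.P K).m + (F.P K).K) (lam : Fin (3 + 1)) (y : Site (F.P K) (k + 1)) (x' : Site (F.P K) 0)
    (μ' : Fin (3 + 1)) (r s : Fin (3 + 1) → ℤ) (hr : toT (d := 3 + 1) (fine (d := 3 + 1) ((F.P K).L ^ (k + 1)) (Mk (F.P K) (k + 1))) (r + s) = EK hk x') :
    windowResp F k K Finset.univ (lam, y) ⟨x', μ'⟩ =
      (∑' m : Fin (3 + 1) → ℤ, imgKer ((F.P K).L ^ (k + 1)) μ' lam
        (translate (fine (d := 3 + 1) ((F.P K).L ^ (k + 1)) (Mk (F.P K) (k + 1)))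
          (r + s - (((F.P K).L ^ (k + 1) : ℕ) : ℤ) • rep (d := 3 + 1) (Mk (F.P K) (k + 1)) y) m)).re := by
  rw [windowResp_univ_eq_re_HkOp F hk (lam, y) ⟨x', μ'⟩]
  show (hker ((F.P K).L ^ (k + 1)) (Mk (F.P K) (k + 1)) μ' lam (EK hk x') y).re = _
  have h := hker_toT_eq_tsum_imgKer ((F.P K).L ^ (k + 1)) (Mk (F.P K) (k + 1)) (one_le_Mk F K (k + 1)) μ' lam (r + s)
    (rep (d := 3 + 1) (Mk (F.P K) (k + 1)) y)
  rw [toT_rep, hr] at h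
  exact congrArg Complex.re h

/-- Bookkeeping: a finite sum of real parts of convergent series is the real part of the series of the finite sums. [folklore] -/
theorem sum_re_tsum_eq {ι : Type*} (t : Finset ι) (f : ι → (Fin (3 + 1) → ℤ) → ℂ) (hf : ∀ i ∈ t, Summable (f i)) :
    ∑ i ∈ t, (∑' m : Fin (3 + 1) → ℤ, f i m).re = (∑' m : Fin (3 + 1) → ℤ, ∑ i ∈ t, f i m).re := by
  rw [Summable.tsum_finsetSum hf, Complex.re_sum]

/-- Summability of the periodised kernel at the record (any stencil step `|s_i| ≤ 2`, any direction). [cite: Balaban1984PropagatorsI, (1.65) p.29] -/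
theorem summable_imgKer_translate_record (lam : Fin (3 + 1)) (y : Site (F.P K) (k + 1)) (μ' : Fin (3 + 1)) (r s : Fin (3 + 1) → ℤ) (hs : ∀ i, |s i| ≤ 2) :
    Summable (fun m : Fin (3 + 1) → ℤ => imgKer ((F.P K).L ^ (k + 1)) μ' lam
      (translate (fine (d := 3 + 1) ((F.P K).L ^ (k + 1)) (Mk (F.P K) (k + 1)))
        (r + s - (((F.P K).L ^ (k + 1) : ℕ) : ℤ) • rep (d := 3 + 1) (Mk (F.P K) (k + 1)) y) m)) := by
  have h := summable_imgKer_translate ((F.P K).L ^ (k + 1)) (Mk (F.P K) (k + 1)) (one_le_Mk F K (k + 1)) μ' lam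
    (r - (((F.P K).L ^ (k + 1) : ℕ) : ℤ) • rep (d := 3 + 1) (Mk (F.P K) (k + 1)) y) s hs
  refine h.congr fun m => ?_
  have e : translate (fine (d := 3 + 1) ((F.P K).L ^ (k + 1)) (Mk (F.P K) (k + 1))) (r - (((F.P K).L ^ (k + 1) : ℕ) : ℤ) • rep (d := 3 + 1) (Mk (F.P K) (k + 1)) y) m + s =
      translate (fine (d := 3 + 1) ((F.P K).L ^ (k + 1)) (Mk (F.P K) (k + 1))) (r + s - (((F.P K).L ^ (k + 1) : ℕ) : ℤ) • rep (d := 3 + 1) (Mk (F.P K) (k + 1)) y) m := by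
    rw [← translate_add_right, sub_add_eq_add_sub]
  rw [e]

/-- The translate of a shifted base: `(r + s − n·w) + N∘m = ((r − n·w) + N∘m) + s`. [folklore] -/
theorem translate_shift_eq (N : Fin (3 + 1) → ℕ) (r s w m : Fin (3 + 1) → ℤ) (c : ℤ) :
    translate N (r + s - c • w) m = translate N (r - c • w) m + s := by
  rw [← translate_add_right, sub_add_eq_add_sub]

/-- ★★ **THE FIRST-DIFFERENCE STENCIL IS A PERIODISATION OF `kerDiff`**: `W⟨x+e_ν, μ⟩ − W⟨x, μ⟩ = Re Σ_m kerDiff n μ λ ν ((r − n·rep y) + (nM)∘m)`.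
[cite: Balaban1985Variational, (190) p.308; Balaban1984PropagatorsI, (1.63) p.28] -/
theorem diffStencil_windowResp_univ_eq (hk : k + 1 ≤ (F.P K).m + (F.P K).K) (lam : Fin (3 + 1)) (y : Site (F.P K) (k + 1)) (x : Site (F.P K) 0)
    (μ ν : Fin (3 + 1)) (r : Fin (3 + 1) → ℤ) (hr : toT (d := 3 + 1) (fine (d := 3 + 1) ((F.P K).L ^ (k + 1)) (Mk (F.P K) (k + 1))) r = EK hk x) :
    windowResp F k K Finset.univ (lam, y) ⟨x.shift ν, μ⟩ - windowResp F k K Finset.univ (lam, y) ⟨x, μ⟩ =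
      (∑' m : Fin (3 + 1) → ℤ, kerDiff ((F.P K).L ^ (k + 1)) μ lam ν
        (translate (fine (d := 3 + 1) ((F.P K).L ^ (k + 1)) (Mk (F.P K) (k + 1)))
          (r - (((F.P K).L ^ (k + 1) : ℕ) : ℤ) • rep (d := 3 + 1) (Mk (F.P K) (k + 1)) y) m)).re := by
  set n : ℕ := (F.P K).L ^ (k + 1) with hn
  set T : Fin (3 + 1) → ℕ := fine (d := 3 + 1) n (Mk (F.P K) (k + 1)) with hT
  set w : Fin (3 + 1) → ℤ := rep (d := 3 + 1) (Mk (F.P K) (k + 1)) y with hw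
  have h0 : toT (d := 3 + 1) T (r + 0) = EK hk x := by rw [add_zero]; exact hr
  have S := summable_imgKer_translate_record F (K := K) (k := k) lam y μ r
  rw [windowResp_univ_eq_re_tsum F hk lam y (x.shift ν) μ r (unitVec ν) (toT_add_unitVec_eq_EK_shift F hk x r hr ν),
    windowResp_univ_eq_re_tsum F hk lam y x μ r 0 h0, ← Complex.sub_re,
    ← (S (unitVec ν) (fun i => (abs_unitVec_le ν i).1)).tsum_sub (S 0 abs_zero_step_le)]
  refine congrArg Complex.re (tsum_congr fun m => ?_)
  show imgKer n μ lam (translate T (r + unitVec ν - (n : ℤ) • w) m) - imgKer n μ lam (translate T (r + 0 - (n : ℤ) • w) m) =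
    imgKer n μ lam (translate T (r - (n : ℤ) • w) m + unitVec ν) - imgKer n μ lam (translate T (r - (n : ℤ) • w) m)
  rw [translate_shift_eq, translate_shift_eq, add_zero]

/-- ★★ **THE LAPLACIAN STENCIL IS A PERIODISATION OF `kerLap`**: `Σ_ν [W⟨x+e_ν,μ⟩ − 2W⟨x,μ⟩ + W⟨x−e_ν,μ⟩] = Re Σ_m kerLap n μ λ ((r − n·rep y) + (nM)∘m)`.
[cite: Balaban1985Variational, (190) p.308; Balaban1984PropagatorsI, (1.63) p.28, (1.21) p.21] -/
theorem lapStencil_windowResp_univ_eq (hk : k + 1 ≤ (F.P K).m + (F.P K).K) (lam : Fin (3 + 1)) (y : Site (F.P K) (k + 1)) (x : Site (F.P K) 0)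
    (μ : Fin (3 + 1)) (r : Fin (3 + 1) → ℤ) (hr : toT (d := 3 + 1) (fine (d := 3 + 1) ((F.P K).L ^ (k + 1)) (Mk (F.P K) (k + 1))) r = EK hk x) :
    ∑ ν : Fin (3 + 1), (windowResp F k K Finset.univ (lam, y) ⟨x.shift ν, μ⟩ - 2 * windowResp F k K Finset.univ (lam, y) ⟨x, μ⟩ +
        windowResp F k K Finset.univ (lam, y) ⟨x.unshift ν, μ⟩) =
      (∑' m : Fin (3 + 1) → ℤ, kerLap ((F.P K).L ^ (k + 1)) μ lam
        (translate (fine (d := 3 + 1) ((F.P K).L ^ (k + 1)) (Mk (F.P K) (k + 1)))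
          (r - (((F.P K).L ^ (k + 1) : ℕ) : ℤ) • rep (d := 3 + 1) (Mk (F.P K) (k + 1)) y) m)).re := by
  set n : ℕ := (F.P K).L ^ (k + 1) with hn
  set T : Fin (3 + 1) → ℕ := fine (d := 3 + 1) n (Mk (F.P K) (k + 1)) with hT
  set w : Fin (3 + 1) → ℤ := rep (d := 3 + 1) (Mk (F.P K) (k + 1)) y with hw
  have h0 : toT (d := 3 + 1) T (r + 0) = EK hk x := by rw [add_zero]; exact hr
  have S := summable_imgKer_translate_record F (K := K) (k := k) lam y μ r
  have S1 := fun ν : Fin (3 + 1) => S (unitVec ν) (fun i => (abs_unitVec_le ν i).1)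
  have S2 := (S 0 abs_zero_step_le).mul_left 2
  have S3 := fun ν : Fin (3 + 1) => S (-unitVec ν) (fun i => (abs_unitVec_le ν i).2)
  -- each summand is the real part of one series
  have hterm : ∀ ν : Fin (3 + 1), windowResp F k K Finset.univ (lam, y) ⟨x.shift ν, μ⟩ - 2 * windowResp F k K Finset.univ (lam, y) ⟨x, μ⟩ +
      windowResp F k K Finset.univ (lam, y) ⟨x.unshift ν, μ⟩ =
      (∑' m : Fin (3 + 1) → ℤ, (imgKer n μ lam (translate T (r + unitVec ν - (n : ℤ) • w) m) - 2 * imgKer n μ lam (translate T (r + 0 - (n : ℤ) • w) m) +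
        imgKer n μ lam (translate T (r + -unitVec ν - (n : ℤ) • w) m))).re := by
    intro ν
    rw [windowResp_univ_eq_re_tsum F hk lam y (x.shift ν) μ r (unitVec ν) (toT_add_unitVec_eq_EK_shift F hk x r hr ν),
      windowResp_univ_eq_re_tsum F hk lam y x μ r 0 h0,
      windowResp_univ_eq_re_tsum F hk lam y (x.unshift ν) μ r (-unitVec ν) (toT_sub_unitVec_eq_EK_unshift F hk x r hr ν),
      ((S1 ν).sub S2).tsum_add (S3 ν), (S1 ν).tsum_sub S2, tsum_mul_left]
    simp only [Complex.add_re, Complex.sub_re, Complex.mul_re, Complex.re_ofNat, Complex.im_ofNat, zero_mul, sub_zero]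
  have H1 := Finset.sum_congr rfl fun ν (_ : ν ∈ (Finset.univ : Finset (Fin (3 + 1)))) => hterm ν
  refine H1.trans ?_
  rw [sum_re_tsum_eq Finset.univ _ fun ν _ => ((S1 ν).sub S2).add (S3 ν)]
  refine congrArg Complex.re (tsum_congr fun m => ?_)
  show ∑ ν : Fin (3 + 1), (imgKer n μ lam (translate T (r + unitVec ν - (n : ℤ) • w) m) - 2 * imgKer n μ lam (translate T (r + 0 - (n : ℤ) • w) m) +
      imgKer n μ lam (translate T (r + -unitVec ν - (n : ℤ) • w) m)) =
    ∑ ν : Fin (3 + 1), (imgKer n μ lam (translate T (r - (n : ℤ) • w) m + unitVec ν) - 2 * imgKer n μ lam (translate T (r - (n : ℤ) • w) m) +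
      imgKer n μ lam (translate T (r - (n : ℤ) • w) m - unitVec ν))
  refine Finset.sum_congr rfl fun ν _ => ?_
  rw [translate_shift_eq, translate_shift_eq, translate_shift_eq, add_zero, ← sub_eq_add_neg]

/-- ★★ **THE CURL (`∂*∂`) STENCIL IS A PERIODISATION OF `kerCurl`**: the token's plaquette stencil of `W = windowResp F k K univ (λ, y)` at `⟨x, μ⟩` equals
`Re Σ_m kerCurl n μ λ ((r − n·rep y) + (nM)∘m)`. [cite: Balaban1985Variational, (190) p.308, (137) p.298; Balaban1985RegularSpaces, (1.2) p.76; Balaban1984PropagatorsI, (1.63) p.28] -/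
theorem curlStencil_windowResp_univ_eq (hk : k + 1 ≤ (F.P K).m + (F.P K).K) (lam : Fin (3 + 1)) (y : Site (F.P K) (k + 1)) (x : Site (F.P K) 0)
    (μ : Fin (3 + 1)) (r : Fin (3 + 1) → ℤ) (hr : toT (d := 3 + 1) (fine (d := 3 + 1) ((F.P K).L ^ (k + 1)) (Mk (F.P K) (k + 1))) r = EK hk x) :
    letI W : PBond (F.P K) 0 → ℝ := windowResp F k K Finset.univ (lam, y)
    ∑ ν : Fin (3 + 1), ((W ⟨x, μ⟩ + W ⟨x.shift μ, ν⟩ - W ⟨x.shift ν, μ⟩ - W ⟨x, ν⟩) -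
        (W ⟨x.unshift ν, μ⟩ + W ⟨(x.unshift ν).shift μ, ν⟩ - W ⟨(x.unshift ν).shift ν, μ⟩ - W ⟨x.unshift ν, ν⟩)) =
      (∑' m : Fin (3 + 1) → ℤ, kerCurl ((F.P K).L ^ (k + 1)) μ lam
        (translate (fine (d := 3 + 1) ((F.P K).L ^ (k + 1)) (Mk (F.P K) (k + 1)))
          (r - (((F.P K).L ^ (k + 1) : ℕ) : ℤ) • rep (d := 3 + 1) (Mk (F.P K) (k + 1)) y) m)).re := by
  set n : ℕ := (F.P K).L ^ (k + 1) with hn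
  set T : Fin (3 + 1) → ℕ := fine (d := 3 + 1) n (Mk (F.P K) (k + 1)) with hT
  set w : Fin (3 + 1) → ℤ := rep (d := 3 + 1) (Mk (F.P K) (k + 1)) y with hw
  -- the eight stencil points as integer steps from `r`
  have h0 : toT (d := 3 + 1) T (r + 0) = EK hk x := by rw [add_zero]; exact hr
  have hμ : toT (d := 3 + 1) T (r + unitVec μ) = EK hk (x.shift μ) := toT_add_unitVec_eq_EK_shift F hk x r hr μ
  have hν : ∀ ν : Fin (3 + 1), toT (d := 3 + 1) T (r + unitVec ν) = EK hk (x.shift ν) := fun ν => toT_add_unitVec_eq_EK_shift F hk x r hr ν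
  have hν' : ∀ ν : Fin (3 + 1), toT (d := 3 + 1) T (r + -unitVec ν) = EK hk (x.unshift ν) := fun ν => toT_sub_unitVec_eq_EK_unshift F hk x r hr ν
  have hν'μ : ∀ ν : Fin (3 + 1), toT (d := 3 + 1) T (r + (-unitVec ν + unitVec μ)) = EK hk ((x.unshift ν).shift μ) := fun ν => by
    rw [← add_assoc]; exact toT_add_unitVec_eq_EK_shift F hk (x.unshift ν) (r + -unitVec ν) (hν' ν) μ
  have hν'ν : ∀ ν : Fin (3 + 1), toT (d := 3 + 1) T (r + (-unitVec ν + unitVec ν)) = EK hk ((x.unshift ν).shift ν) := fun ν => by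
    rw [← add_assoc]; exact toT_add_unitVec_eq_EK_shift F hk (x.unshift ν) (r + -unitVec ν) (hν' ν) ν
  -- summability of every term
  have S : ∀ (μ' : Fin (3 + 1)) (s : Fin (3 + 1) → ℤ), (∀ i, |s i| ≤ 2) → Summable (fun m : Fin (3 + 1) → ℤ => imgKer n μ' lam (translate T (r + s - (n : ℤ) • w) m)) :=
    fun μ' s hs => summable_imgKer_translate_record F (K := K) (k := k) lam y μ' r s hs
  have s0 : ∀ i : Fin (3 + 1), |(0 : Fin (3 + 1) → ℤ) i| ≤ 2 := abs_zero_step_le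
  have s1 : ∀ ν i : Fin (3 + 1), |unitVec ν i| ≤ 2 := fun ν i => (abs_unitVec_le ν i).1
  have s2 : ∀ ν i : Fin (3 + 1), |(-unitVec ν) i| ≤ 2 := fun ν i => (abs_unitVec_le ν i).2
  have s3 : ∀ ν i : Fin (3 + 1), |(-unitVec ν + unitVec μ) i| ≤ 2 := fun ν i => (abs_unitVec_add_le ν μ i).1
  have s4 : ∀ ν i : Fin (3 + 1), |(-unitVec ν + unitVec ν) i| ≤ 2 := fun ν i => (abs_unitVec_add_le ν ν i).2
  have A1 := S μ 0 s0
  have A2 := fun ν : Fin (3 + 1) => S ν (unitVec μ) (s1 μ)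
  have A3 := fun ν : Fin (3 + 1) => S μ (unitVec ν) (s1 ν)
  have A4 := fun ν : Fin (3 + 1) => S ν 0 s0
  have B1 := fun ν : Fin (3 + 1) => S μ (-unitVec ν) (s2 ν)
  have B2 := fun ν : Fin (3 + 1) => S ν (-unitVec ν + unitVec μ) (s3 ν)
  have B3 := fun ν : Fin (3 + 1) => S μ (-unitVec ν + unitVec ν) (s4 ν)
  have B4 := fun ν : Fin (3 + 1) => S ν (-unitVec ν) (s2 ν)
  have hterm : ∀ ν : Fin (3 + 1), ((windowResp F k K Finset.univ (lam, y) ⟨x, μ⟩ + windowResp F k K Finset.univ (lam, y) ⟨x.shift μ, ν⟩ -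
        windowResp F k K Finset.univ (lam, y) ⟨x.shift ν, μ⟩ - windowResp F k K Finset.univ (lam, y) ⟨x, ν⟩) -
      (windowResp F k K Finset.univ (lam, y) ⟨x.unshift ν, μ⟩ + windowResp F k K Finset.univ (lam, y) ⟨(x.unshift ν).shift μ, ν⟩ -
        windowResp F k K Finset.univ (lam, y) ⟨(x.unshift ν).shift ν, μ⟩ - windowResp F k K Finset.univ (lam, y) ⟨x.unshift ν, ν⟩)) =
      (∑' m : Fin (3 + 1) → ℤ,
        ((imgKer n μ lam (translate T (r + 0 - (n : ℤ) • w) m) + imgKer n ν lam (translate T (r + unitVec μ - (n : ℤ) • w) m) -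
            imgKer n μ lam (translate T (r + unitVec ν - (n : ℤ) • w) m) - imgKer n ν lam (translate T (r + 0 - (n : ℤ) • w) m)) -
          (imgKer n μ lam (translate T (r + -unitVec ν - (n : ℤ) • w) m) + imgKer n ν lam (translate T (r + (-unitVec ν + unitVec μ) - (n : ℤ) • w) m) -
            imgKer n μ lam (translate T (r + (-unitVec ν + unitVec ν) - (n : ℤ) • w) m) - imgKer n ν lam (translate T (r + -unitVec ν - (n : ℤ) • w) m)))).re := by
    intro ν
    rw [windowResp_univ_eq_re_tsum F hk lam y x μ r 0 h0, windowResp_univ_eq_re_tsum F hk lam y (x.shift μ) ν r (unitVec μ) hμ,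
      windowResp_univ_eq_re_tsum F hk lam y (x.shift ν) μ r (unitVec ν) (hν ν), windowResp_univ_eq_re_tsum F hk lam y x ν r 0 h0,
      windowResp_univ_eq_re_tsum F hk lam y (x.unshift ν) μ r (-unitVec ν) (hν' ν),
      windowResp_univ_eq_re_tsum F hk lam y ((x.unshift ν).shift μ) ν r (-unitVec ν + unitVec μ) (hν'μ ν),
      windowResp_univ_eq_re_tsum F hk lam y ((x.unshift ν).shift ν) μ r (-unitVec ν + unitVec ν) (hν'ν ν),
      windowResp_univ_eq_re_tsum F hk lam y (x.unshift ν) ν r (-unitVec ν) (hν' ν),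
      ← Complex.add_re, ← Complex.sub_re, ← Complex.sub_re, ← Complex.add_re, ← Complex.sub_re, ← Complex.sub_re, ← Complex.sub_re,
      ← A1.tsum_add (A2 ν), ← (A1.add (A2 ν)).tsum_sub (A3 ν), ← ((A1.add (A2 ν)).sub (A3 ν)).tsum_sub (A4 ν),
      ← (B1 ν).tsum_add (B2 ν), ← ((B1 ν).add (B2 ν)).tsum_sub (B3 ν), ← (((B1 ν).add (B2 ν)).sub (B3 ν)).tsum_sub (B4 ν),
      ← ((((A1.add (A2 ν)).sub (A3 ν)).sub (A4 ν))).tsum_sub ((((B1 ν).add (B2 ν)).sub (B3 ν)).sub (B4 ν))]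
  have hsum : ∀ ν : Fin (3 + 1), Summable (fun m : Fin (3 + 1) → ℤ =>
      (imgKer n μ lam (translate T (r + 0 - (n : ℤ) • w) m) + imgKer n ν lam (translate T (r + unitVec μ - (n : ℤ) • w) m) -
          imgKer n μ lam (translate T (r + unitVec ν - (n : ℤ) • w) m) - imgKer n ν lam (translate T (r + 0 - (n : ℤ) • w) m)) -
        (imgKer n μ lam (translate T (r + -unitVec ν - (n : ℤ) • w) m) + imgKer n ν lam (translate T (r + (-unitVec ν + unitVec μ) - (n : ℤ) • w) m) -
          imgKer n μ lam (translate T (r + (-unitVec ν + unitVec ν) - (n : ℤ) • w) m) - imgKer n ν lam (translate T (r + -unitVec ν - (n : ℤ) • w) m))) :=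
    fun ν => (((A1.add (A2 ν)).sub (A3 ν)).sub (A4 ν)).sub ((((B1 ν).add (B2 ν)).sub (B3 ν)).sub (B4 ν))
  show ∑ ν : Fin (3 + 1), _ = _
  have H1 := Finset.sum_congr rfl fun ν (_ : ν ∈ (Finset.univ : Finset (Fin (3 + 1)))) => hterm ν
  refine H1.trans ?_
  rw [sum_re_tsum_eq Finset.univ _ fun ν _ => hsum ν]
  refine congrArg Complex.re (tsum_congr fun m => ?_)
  unfold kerCurl
  refine Finset.sum_congr rfl fun ν _ => ?_
  simp only [translate_shift_eq, add_zero]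
  simp only [sub_eq_add_neg, add_assoc, hn]

end Record

end Summit.QuantumFields.YangMills.Theorems.PortU8.Images

end
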